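import Summits.ValiantsHypothesis.ValiantsHypothesis.Theorems.DepthWindowBDSSequences
import Summits.ValiantsHypothesis.ValiantsHypothesis.Theorems.DepthWindowHomImmHardLt
import HarnessLib

/-!
# Route `DepthWindow` — the asymptotic fit of the BDS word at slope `7/5` (PLAN-w2, file F5′-fit)

Helper file of the route `Theses/DepthWindow.lean` (decomp-valiant workshop, lens 4, generation 10).  The port of
[BhargavDuttaSaxena2024, Thm 1.2] towards `HomImmHardAt 7 5` (support item `HomImmHardSubReach`) ends with a FIT:
in the regime of the item — `n = m` matrices, `L = ⌊log₂ m⌋`, degree `d = ⌊√L⌋`, product-depth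
`Δ′ = ⌊7v/5⌋ + c` with `v = ⌊log₂ ⌊log₂ L⌋⌋` — the integer parameter `λ = C·Δ′` of the two-letter word must satisfy
`λ^{G(Δ′)} ≤ d`, `G(Δ′) = F_{Δ′+2} - 1` ([BhargavDuttaSaxena2024, Lemma 4.3]: the top threshold `b_{Δ′} ≤ λ^{G(Δ′)}` must not
exceed the degree).  This file proves that fit, for EVERY constant `C`, in the integer pattern of `homFit_eventually`:

* `fib_depth_le : F_{⌊7v/5⌋+c+2} ≤ 2^{⌊49v/50⌋+c+2}` — from `F_{n+2}^10 ≤ 2^{7n+10}` (`DepthWindowBDSSequences`); the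
  margin is the exponent `49/50 < 1`: the growth rate `0.7` of the Fibonacci bound times the slope `7/5` is `0.98`;
* `base_pow_fib_le_sqrt : ∃ L₀, ∀ L ≥ L₀, (C·Δ′)^{F_{Δ′+2}} ≤ ⌊√L⌋` (so a fortiori `λ^{G(Δ′)} ≤ d` and `λ b_{Δ′} ≤ λ d`);
* `fit` — the package at `C = 256(c+2)` with the side conditions `2 ≤ Δ′` and `4⌊√L⌋ ≤ L`.

This is the cheapest falsifier of the whole port (critic, bus 2026-08-30T06:14:06Z): had the exponent come out `≥ 1`
no choice of constants could serve slope `7/5`.  Pure `ℕ` arithmetic, 0 sorry; rung currency only — nothing here bears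
on `VP ≠ VNP` itself.

References: [BhargavDuttaSaxena2024] Thm 1.2, Lemma 4.3; [LimayeSrinivasanTavenas2025] Thm 1 (the range `d ≤ (log n)/…`).
-/

-- layout Summits/ValiantsHypothesis/ValiantsHypothesis forces the duplicated namespace component
set_option linter.dupNamespace false

namespace Summit.ValiantsHypothesis.ValiantsHypothesis.Theorems.DepthWindow.BDS

open Nat

/-- The exponent at slope `7/5`: `F_{⌊7v/5⌋ + c + 2} ≤ 2^{⌊49v/50⌋ + c + 2}` (growth rate `0.7 · 7/5 = 0.98 < 1`). -/
theorem fib_depth_le (v c : ℕ) : fib (7 * v / 5 + c + 2) ≤ 2 ^ (49 * v / 50 + c + 2) := by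
  have h10 := fib_succ_succ_pow_ten_le (7 * v / 5 + c)
  have hexp : 7 * (7 * v / 5 + c) + 10 ≤ 10 * (49 * v / 50 + c + 2) := by omega
  have h : fib (7 * v / 5 + c + 2) ^ 10 ≤ (2 ^ (49 * v / 50 + c + 2)) ^ 10 :=
    calc fib (7 * v / 5 + c + 2) ^ 10 ≤ 2 ^ (7 * (7 * v / 5 + c) + 10) := h10
      _ ≤ 2 ^ (10 * (49 * v / 50 + c + 2)) := Nat.pow_le_pow_right (by norm_num) hexp
      _ = (2 ^ (49 * v / 50 + c + 2)) ^ 10 := by rw [← pow_mul, mul_comm]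
  exact (Nat.pow_le_pow_iff_left (by norm_num)).1 h

/-- **The fit at slope `7/5`**: for every constant `C` and depth offset `c`, eventually in `L`,
`(C·Δ′)^{F_{Δ′+2}} ≤ ⌊√L⌋` where `Δ′ = ⌊7v/5⌋ + c`, `v = ⌊log₂ ⌊log₂ L⌋⌋`.  (With `w = ⌊v/50⌋`: the base costs
`C·Δ′·2^{c+3} ≤ 2^w` by the linear-vs-exponential threshold `lin_le_two_pow`, the exponent `≤ 2^{⌊49v/50⌋+c+2}`, and
`w + ⌊49v/50⌋ ≤ v`; so `2·(CΔ′)·F_{Δ′+2} ≤ 2^v ≤ ⌊log₂ L⌋` and `(CΔ′)^{2F} ≤ 2^{2 CΔ′ F} ≤ L`.) -/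
theorem base_pow_fib_le_sqrt (C c : ℕ) : ∃ L₀ : ℕ, ∀ L : ℕ, L₀ ≤ L →
    (C * (7 * log 2 (log 2 L) / 5 + c)) ^ fib (7 * log 2 (log 2 L) / 5 + c + 2) ≤ Nat.sqrt L := by
  -- the linear-vs-exponential threshold
  set a := 100 * C * 2 ^ (c + 3) with ha
  set b := C * (98 + c) * 2 ^ (c + 3) with hb
  set w₀ := 2 * (a + b + 1) with hw₀
  refine ⟨2 ^ 2 ^ (50 * w₀), fun L hL => ?_⟩
  set u := log 2 L with hu
  set v := log 2 u with hv
  have hL0 : L ≠ 0 := by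
    have : 1 ≤ 2 ^ 2 ^ (50 * w₀) := Nat.one_le_two_pow
    omega
  have huge : 2 ^ (50 * w₀) ≤ u := Nat.le_log_of_pow_le (by norm_num) hL
  have hu0 : u ≠ 0 := by
    have : 1 ≤ 2 ^ (50 * w₀) := Nat.one_le_two_pow
    omega
  have hvge : 50 * w₀ ≤ v := Nat.le_log_of_pow_le (by norm_num) huge
  have h2v : 2 ^ v ≤ u := Nat.pow_log_le_self 2 hu0
  have h2u : 2 ^ u ≤ L := Nat.pow_log_le_self 2 hL0
  -- `w = ⌊v/50⌋`
  set w := v / 50 with hw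
  have hw₀w : w₀ ≤ w := by omega
  have hv50 : v ≤ 50 * w + 49 := by omega
  have hv1 : 1 ≤ v := by omega
  set Δ' := 7 * v / 5 + c with hΔ'
  set X := C * Δ' with hX
  set E := fib (Δ' + 2) with hE
  have hEle : E ≤ 2 ^ (49 * v / 50 + c + 2) := fib_depth_le v c
  -- the base
  have hXle : X * 2 ^ (c + 3) ≤ 2 ^ w := by
    have hΔ : Δ' ≤ 2 * (50 * w + 49) + c := by omega
    calc X * 2 ^ (c + 3) ≤ C * (2 * (50 * w + 49) + c) * 2 ^ (c + 3) :=
          Nat.mul_le_mul_right _ (Nat.mul_le_mul_left _ hΔ)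
      _ = a * w + b := by rw [ha, hb]; ring
      _ ≤ 2 ^ w := lin_le_two_pow a b w hw₀w
  -- base times exponent
  have hXE : X * E * 2 ^ (c + 3) ≤ 2 ^ (v + c + 2) := by
    calc X * E * 2 ^ (c + 3) = (X * 2 ^ (c + 3)) * E := by ring
      _ ≤ 2 ^ w * 2 ^ (49 * v / 50 + c + 2) := Nat.mul_le_mul hXle hEle
      _ = 2 ^ (w + (49 * v / 50 + c + 2)) := by rw [← pow_add]
      _ ≤ 2 ^ (v + c + 2) := Nat.pow_le_pow_right (by norm_num) (by omega)
  have hXE' : 2 * (X * E) ≤ 2 ^ v := by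
    have e : 2 ^ (v + c + 2) = 2 ^ (v - 1) * 2 ^ (c + 3) := by
      rw [← pow_add]; congr 1; omega
    rw [e] at hXE
    have h := Nat.le_of_mul_le_mul_right hXE (by positivity)
    have e2 : 2 ^ v = 2 * 2 ^ (v - 1) := by
      rw [← pow_succ']; congr 1; omega
    rw [e2]
    exact Nat.mul_le_mul_left _ h
  -- assemble: `(X^E)^2 ≤ 2^{2XE} ≤ 2^u ≤ L`
  rw [Nat.le_sqrt']
  have hXlt : X ≤ 2 ^ X := (Nat.lt_two_pow_self).le
  calc (X ^ E) ^ 2 ≤ ((2 ^ X) ^ E) ^ 2 := Nat.pow_le_pow_left (Nat.pow_le_pow_left hXlt _) _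
    _ = 2 ^ (2 * (X * E)) := by rw [← pow_mul, ← pow_mul]; ring_nf
    _ ≤ 2 ^ u := Nat.pow_le_pow_right (by norm_num) (hXE'.trans h2v)
    _ ≤ L := h2u

/-- **The fit, packaged** for the assembly of `HomImmHardAt 7 5` (`λ = 256(c+2)Δ′`): eventually in `L = ⌊log₂ m⌋`,
`2 ≤ Δ′`, `λ^{F_{Δ′+2}} ≤ ⌊√L⌋ = d` (hence `λ^{G(Δ′)} ≤ d` and, with `λ b_{Δ′} ≤ λ^{F_{Δ′+2}}` of `exists_params`,
`b_{Δ′} ≤ d`), and `4d ≤ L` (room for `q₀ t ≤ log₂ n` with `t ≥ 1`). -/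
theorem fit (c : ℕ) : ∃ L₀ : ℕ, ∀ L : ℕ, L₀ ≤ L →
    2 ≤ 7 * log 2 (log 2 L) / 5 + c ∧
    (256 * (c + 2) * (7 * log 2 (log 2 L) / 5 + c)) ^ fib (7 * log 2 (log 2 L) / 5 + c + 2) ≤ Nat.sqrt L ∧
    4 * Nat.sqrt L ≤ L := by
  obtain ⟨L₀, hL₀⟩ := base_pow_fib_le_sqrt (256 * (c + 2)) c
  refine ⟨max L₀ (2 ^ 2 ^ 2), fun L hL => ⟨?_, hL₀ L (le_of_max_le_left hL), ?_⟩⟩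
  · have hL4 : 2 ^ 2 ^ 2 ≤ L := le_of_max_le_right hL
    have hu : 2 ^ 2 ≤ log 2 L := Nat.le_log_of_pow_le (by norm_num) hL4
    have hv : 2 ≤ log 2 (log 2 L) := Nat.le_log_of_pow_le (by norm_num) hu
    omega
  · have hL16 : 16 ≤ L := le_trans (by norm_num) (le_of_max_le_right hL)
    have h4 : 4 ≤ Nat.sqrt L := by
      rw [Nat.le_sqrt]
      exact hL16
    calc 4 * Nat.sqrt L ≤ Nat.sqrt L * Nat.sqrt L := Nat.mul_le_mul_right _ h4
      _ ≤ L := Nat.sqrt_le L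

end Summit.ValiantsHypothesis.ValiantsHypothesis.Theorems.DepthWindow.BDS
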